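import Summits.ValiantsHypothesis.ValiantsHypothesis.Theorems.GrenetZeonDualUnipotentThreeHalvesHeavyTopCompositionBoundGeneral
import Summits.ValiantsHypothesis.ValiantsHypothesis.Theorems.GrenetZeonDualUnipotentThreeHalvesHeavyTopIotaOfThmC

/-!
# `GrenetZeon.DualUnipotentThreeHalves` (stmt-ValiantsHypothesis-24318), R2 `HeavyTopLaw` — the SINGLE-DATUM census cells
# `(10,14) ⟸ ι(14) ≤ 89`, `(12,17) ⟸ ι(17) ≤ 131`, and `(7,10) ⟸ ι(9) ≤ 34 ∧ ι(10) ≤ 42`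

Instances of the size-general composition bound ✓ `heavyTopInst_of_iota_bound'` / `heavyTopInst_of_iota_bounds` (`…HeavyTopCompositionBoundGeneral`)
in which every two-level coarsening and the compositions `(1,m−1)`, `(m−1,1)`, `(1,m−2,1)` are paid by Gerstenhaber / the TRIVIAL irreducible bounds, so that
ONE datum on irreducible nilpotent subspaces of `M_m(ℂ)` decides the cell (GRID v1.5, lead g4 / val-idea-30 g12: «single-datum cells»):

* ★ `heavyTopInst_ten_fourteen_of_iota (hι14 : ι(14) ≤ 89) : HeavyTopInst 10 14` — `n² = 100`: cuts `≤ 20 + 1 + 66 = 87`, `(1,13)/(13,1)`: `20 + 77 = 97`,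
  `(1,12,1)`: `30 + 65 = 95`, `(14)`: `10 + 89 = 99`.  The director's P-(10,14) target asked for `hι_s`, `s = 8..14`; ONLY `s = 14` is needed.
  `ι(14) ≤ 89 = C(14,2) − 2` is Theorem C(14) («a codimension-one nilpotent subspace of `M₁₄(ℂ)` is reducible»): machine + paper (THMC-CHECK v0.8e,
  idea-30 MEMO codim-one rev 1.2), kernel only for `m ≤ 7` so far — `heavyTopInst_ten_fourteen_of_thmC14` takes it in the Thm-C hypothesis shape of
  ✓ `finrank_le_of_thmC` (`s = 13`).
* `heavyTopInst_twelve_seventeen_of_iota (hι17 : ι(17) ≤ 131) : HeavyTopInst 12 17` — `n² = 144`: cuts `≤ 24 + 1 + 105 = 130`, `24 + 119 = 143`,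
  `36 + 104 = 140`, `12 + 131 = 143`.  (`ι(17) ≤ 131 = C(17,2) − 5` is OPEN: known `ι(17) ∈ [107, 134]`.)
* `heavyTopInst_seven_ten_of_iota (hι9 : ι(9) ≤ 34) (hι10 : ι(10) ≤ 41) : HeavyTopInst 7 10` — `n² = 49`: cuts `≤ 14 + 1 + 28 = 43`,
  `(1,9)/(9,1)`: `14 + 34 = 48` (needs Theorem C(9): `ι(9) ≤ C(9,2) − 2`), `(1,8,1)`: `21 + 27 = 48` (trivial), `(10)`: `7 + 41 = 48`.  NOTE: the cell's
  composition ledger (GRID v1.5) words this cell as «(7,10) ⟺ ι(10) ≤ 42»; under the kernel's strict budget `p·n + Σ D < n²` the irreducible composition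
  needs `7 + ι(10) ≤ 48`, i.e. `ι(10) ≤ 41 = C(10,2) − 4` (as `12 + 131 = 143 < 144` at `(12,17)`) — one unit sharper than the ledger's wording.

HONEST LABEL: CONDITIONAL instance rows (the `ι`-data are open finite questions / paper theorems, taken as hypotheses); nothing here proves the cells outright,
nor `HeavyTopLaw`, 24318, S3b; `VP ≠ VNP` is NOT proved; no summit statement is proved here.  No definitions, no named facts.
[folklore bookkeeping over Theorem G; cell val-heavytop-census, eng-1 g5]
-/

noncomputable section

-- single-conjunct layout: Sub = Summit, duplicated namespace component intended
set_option linter.dupNamespace false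

namespace Summit.ValiantsHypothesis.ValiantsHypothesis.Theorems.GrenetZeon.HeavyTopCompositionBound

open Matrix
open Summit.ValiantsHypothesis.ValiantsHypothesis.Theorems.GrenetZeon.RadicalSplit
open Summit.ValiantsHypothesis.ValiantsHypothesis.Theorems.GrenetZeon.HeavyTopIotaOfThmC (finrank_le_of_thmC)

/-! ## §1 `(10, 14)` from `ι(14) ≤ 89` -/

/-- ★ **P-(10,14): `ι(14) ≤ 89 ⟹ HeavyTopInst 10 14`.**  The hypothesis says: every IRREDUCIBLE nilpotent linear subspace of `M₁₄(ℂ)` has dimension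
`≤ 89 = C(14,2) − 2` (Theorem C(14); machine + paper, not yet kernel).  Everything else is paid by Gerstenhaber and the trivial irreducible bounds.
Conditional instance row; NOT a proof of `HeavyTopInst 10 14`, `HeavyTopLaw` or 24318. [folklore bookkeeping over Theorem G] -/
theorem heavyTopInst_ten_fourteen_of_iota
    (hι14 : ∀ V : Submodule ℂ (Matrix (Fin 14) (Fin 14) ℂ), (∀ A ∈ V, IsNilpotent A) →
      (∀ U : Submodule ℂ (Fin 14 → ℂ), (∀ A ∈ V, ∀ x ∈ U, A *ᵥ x ∈ U) → U = ⊥ ∨ U = ⊤) →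
      Module.finrank ℂ V ≤ 89) :
    HeavyTopInst 10 14 :=
  heavyTopInst_of_iota_bound' (by norm_num) 89 (by decide) (by decide) (by decide) (by decide) hι14

/-- **P-(10,14) in the Theorem-C hypothesis shape**: if every nilpotent `V ≤ M₁₄(ℂ)` of dimension `90 = C(14,2) − 1` containing some `Z` with `Z¹³ ≠ 0`
has a non-trivial proper invariant subspace (Theorem C(14)), then `HeavyTopInst 10 14` (via ✓ `finrank_le_of_thmC`, `s = 13`, which supplies the regular
element by ✓ `exists_regular_of_irreducible_codimOne`).  Conditional. [folklore bookkeeping; this cell] -/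
theorem heavyTopInst_ten_fourteen_of_thmC14
    (hC14 : ∀ V : Submodule ℂ (Matrix (Fin 14) (Fin 14) ℂ), (∀ A ∈ V, IsNilpotent A) → Module.finrank ℂ V = 90 →
      (∃ Z ∈ V, Z ^ 13 ≠ 0) → ¬ ∀ U : Submodule ℂ (Fin 14 → ℂ), (∀ A ∈ V, ∀ x ∈ U, A *ᵥ x ∈ U) → U = ⊥ ∨ U = ⊤) :
    HeavyTopInst 10 14 :=
  heavyTopInst_ten_fourteen_of_iota fun V hV hirr =>
    (finrank_le_of_thmC (s := 13) (by norm_num) (fun W hW hdim hZ => hC14 W hW (by rw [hdim]; decide) hZ) V hV hirr).trans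
      (by decide)

/-! ## §2 `(12, 17)` from `ι(17) ≤ 131` -/

/-- **`ι(17) ≤ 131 ⟹ HeavyTopInst 12 17`** (`131 = C(17,2) − 5`; the datum is an OPEN finite question, known `ι(17) ∈ [107, 134]`).  Conditional instance
row; NOT a proof of `HeavyTopInst 12 17`, `HeavyTopLaw` or 24318. [folklore bookkeeping over Theorem G] -/
theorem heavyTopInst_twelve_seventeen_of_iota
    (hι17 : ∀ V : Submodule ℂ (Matrix (Fin 17) (Fin 17) ℂ), (∀ A ∈ V, IsNilpotent A) →
      (∀ U : Submodule ℂ (Fin 17 → ℂ), (∀ A ∈ V, ∀ x ∈ U, A *ᵥ x ∈ U) → U = ⊥ ∨ U = ⊤) →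
      Module.finrank ℂ V ≤ 131) :
    HeavyTopInst 12 17 :=
  heavyTopInst_of_iota_bound' (by norm_num) 131 (by decide) (by decide) (by decide) (by decide) hι17

/-! ## §3 `(7, 10)` from `ι(9) ≤ 34` and `ι(10) ≤ 41` -/

/-- **`ι(9) ≤ 34 ∧ ι(10) ≤ 41 ⟹ HeavyTopInst 7 10`** (`n² = 49`: cuts `≤ 43`; `(1,9)/(9,1)` cost `14 + 34 = 48` — `ι(9) ≤ 34 = C(9,2) − 2` is Theorem C(9),
paper/machine, not yet kernel —; `(1,8,1)` costs `21 + 27 = 48` with the trivial bound; `(10)` costs `7 + ι(10)` and needs `ι(10) ≤ 41 = C(10,2) − 4`, one unit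
sharper than the ledger's wording «ι(10) ≤ 42» of GRID v1.5).  Conditional instance row; NOT a proof of `HeavyTopInst 7 10`, `HeavyTopLaw` or 24318.
[folklore bookkeeping over Theorem G] -/
theorem heavyTopInst_seven_ten_of_iota
    (hι9 : ∀ V : Submodule ℂ (Matrix (Fin 9) (Fin 9) ℂ), (∀ A ∈ V, IsNilpotent A) →
      (∀ U : Submodule ℂ (Fin 9 → ℂ), (∀ A ∈ V, ∀ x ∈ U, A *ᵥ x ∈ U) → U = ⊥ ∨ U = ⊤) →
      Module.finrank ℂ V ≤ 34)
    (hι10 : ∀ V : Submodule ℂ (Matrix (Fin 10) (Fin 10) ℂ), (∀ A ∈ V, IsNilpotent A) →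
      (∀ U : Submodule ℂ (Fin 10 → ℂ), (∀ A ∈ V, ∀ x ∈ U, A *ᵥ x ∈ U) → U = ⊥ ∨ U = ⊤) →
      Module.finrank ℂ V ≤ 41) :
    HeavyTopInst 7 10 :=
  heavyTopInst_of_iota_bounds (by norm_num) 41 34 27
    (fun _ ha ham => by
      have h28 : (10 - 2).choose 2 = 28 := by decide
      have := choose_two_add_choose_two_sub_le ha ham
      omega) (by decide) (by decide) (by decide) hι10 hι9
    (fun V hV hirr => (finrank_le_choose_two_sub_one_of_irreducible (by norm_num) V hV hirr).trans (by decide))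

end Summit.ValiantsHypothesis.ValiantsHypothesis.Theorems.GrenetZeon.HeavyTopCompositionBound

end
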